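import Literature.Barriers.SmoothPoincare4.OneStabilisationContractibleCorkProofs
import Literature.Barriers.SmoothPoincare4.ExoticContractibleBoundaryDiffeosProofs
import Literature.Barriers.SmoothPoincare4.ExoticContractibleKangStabilisationProofs
import Literature.Topology.FourManifolds.CobordismAttachmentProofs
import Literature.Topology.FourManifolds.BallRemovalCobordism
import Literature.Topology.FourManifolds.InteriorConnectedSum
import Literature.Topology.FourManifolds.GluedDesc
import Literature.Topology.FourManifolds.InteriorLift
import HarnessLib

/-!
# The stabilised Akbulut–Ruberman construction from the leaves of Thm. A (proofs)

Fourth sibling proof file of `Literature/Barriers/SmoothPoincare4/OneStabilisationContractible.lean`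
(barrier `OneStabilisationBarrier`). `OneStabilisationContractibleCorkProofs.lean` splits Kang's
exotic pair (`kang2022_oneStabilisationExoticPair`, proof of Cor. 1.2 of arXiv:2210.07510, §5)
into Kang's Thm. 1.1 (`kang2022_theorem11`, involutive bordered Floer homology) and the named fact
`kang2022_akbulutRubermanStabilised` — Kang's sentence "By following the arguments used in the
proof of [AR16, Theorem A], one can construct a homology cobordism `X` from `Y` to another homology
sphere `N`, admitting a left inverse … such that any self-diffeomorphism of `N` extends to a
self-diffeomorphism of `X` which acts by identity on `Y`. Then we consider the 4-manifolds
`V = W ∪ X`, `V′ = W ∪_f X` … Then one can simply follow the remaining part of the proof of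
[AR16, Theorem A] to conclude that there exists no diffeomorphism between `V ♯ (S² × S²)` and
`V′ ♯ (S² × S²)`."

This file PROVES that fact from the two named facts into which the tree already decomposes the
UNSTABILISED Thm. A of Akbulut–Ruberman (`ExoticContractibleTheoremAProofs.lean`):
(C) `akbulutRuberman2016_symmetryKillingCobordism` (Lemma 2.3, Cor. 2.5, Prop. 2.6 and the Claim of
§3: hyperbolic 3-manifold theory, the deep leaf) and (R) `akbulutRuberman2016_relativelyExotic`
(the "(E:twist)" paragraph of §3, stated there for EVERY compact `W`), together with the tree's
PROVED (G) `exists_cobordismAttachment_holds` (Milnor 1965, Thm. 1.4), (S)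
`akbulutRuberman2016_boundaryDiffeosExtend_holds` and Lemma 1.2
(`isEmpty_diffeomorph_of_lemma12`):

`kang2022_akbulutRubermanStabilised_of_AR (hC) (hR) : kang2022_akbulutRubermanStabilised`.

The point, as in Kang's "with `W ♯ (S² × S²)` in place of `W`": (R) and (S) apply verbatim to
the compact 4-manifold `P₀ = W ♯ (S² × S²)` (boundary `∂W`), and the manifolds `P₀ ∪ X`,
`P₀ ∪_f X` they speak about ARE connected sums `(W ∪ X) ♯ (S² × S²)`, `(W ∪_f X) ♯ (S² × S²)` of
the contractible `V = W ∪ X`, `V′ = W ∪_f X`. In the tree's relational setting (attachments and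
connected sums are witnesses, unique only up to diffeomorphism) this commutation is not a
tautology: a witness of `P₀ ∪ X` and a witness of `V ♯ (S² × S²)` chosen independently are related
by no preferred map (naively pasted maps are not smooth across the seam). It is obtained here by
CONSTRUCTING `V ♯ (S² × S²)` from any witness `V` of `W ∪_ψ X` as the explicit glued manifold of
`Literature/Topology/FourManifolds/InteriorConnectedSum.lean` along the transported disc `jW ∘ i`,
and exhibiting on it the structure of a witness of `P₀ ∪_ψ X` (`ARStab.attachment`).

## Contents (everything is proved; no definitions of facts, no new named facts)

* `exists_isInteriorPoint_of_nonempty`, `exists_disc`: a nonempty manifold with boundary has an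
  interior point and a disc; `exists_disc_sphereTwoProd`, `sphereProdLin`,
  `nonempty_stabilisationData`: stabilisation data `InteriorSumData 3 W ((𝓡 2).prod (𝓡 2)) (S² × S²)`
  exist for every nonempty smooth 4-manifold with boundary.
* `extendsOverStabilisation_of_extendsToDiffeomorph`: a boundary diffeomorphism extending over the
  explicit `W ♯ (S² × S²)` extends over a stabilisation (`ExtendsOverStabilisation`, Cork file);
  `extendsOverStabilisation_refl`: **non-vacuity** — the identity always extends.
* `ARStab.*`: for `A : CobordismAttachment b X ψ V` and stabilisation data `D` of `W`: the
  transported disc `jW ∘ i` of `V` (`isSmoothEmbedding_jW_comp_disc`), the data `sumDataV`, the map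
  `jW₁ : W ♯ Y → V ♯ Y` (descended from the pieces; an injective immersion of a compact manifold,
  hence a smooth embedding), `jX₁ : X → V ♯ Y`, and **`ARStab.attachment : CobordismAttachment
  (D.boundaryData b) X ψ (sumDataV D b A).P`** — `V ♯ Y = (W ♯ Y) ∪_ψ X`.
* `kang2022_akbulutRubermanStabilised_of_AR`; corollaries
  `kang2022_oneStabilisationExoticPair_of_theorem11_AR`, `oneStabilisationBarrier_of_theorem11_AR`.

Resulting DAG (all arrows proved): `kang2022_akbulutRubermanStabilised ⇐ (C) ∧ (R)`, hence
`kang2022_oneStabilisationExoticPair ⇐ kang2022_theorem11 ∧ (C) ∧ (R)` and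
`OneStabilisationBarrier ⇐ kang2022_theorem11 ∧ (C) ∧ (R) ∧ Freedman–Quinn`: the stabilised
mechanism is no longer an independent leaf.

## What is printed

* Kang (arXiv:2210.07510v3), proof of Cor. 1.2 (§5, pp. 20–21), quoted above.
* Akbulut–Ruberman (arXiv:1410.1461 = Comment. Math. Helv. 91 (2016)), §3, proof of Thm. A
  (Thm. "T:general" there, for ANY compact `W` with a relatively exotic `(W, f)`): "Write `V′` for
  `X ∪_f W` … If `V′` were diffeomorphic to `V`, preserving this marking, then we could glue this
  diffeomorphism to the identity of `X̄` to get a diffeomorphism `X̄ ∪_N X ∪_f W ≅ W`. But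
  `X̄ ∪_N X ≅ N × I` … It follows that (E:twist) would result in a diffeomorphism of `(W, f)` with
  `(W, id)`" and "By the claim above and Lemma (L:extend), there is no diffeomorphism between `V`
  and `V′`."

## References

* S. Kang, *One stabilization is not enough for contractible 4-manifolds*, arXiv:2210.07510,
  Cor. 1.2 and its proof (§5). [Kang2022OneStabilization]
* S. Akbulut, D. Ruberman, *Absolutely exotic compact 4-manifolds*, Comment. Math. Helv. 91 (2016)
  1–19, §3. [AkbulutRuberman2016]
* J. Milnor, *Lectures on the h-cobordism theorem* (1965), §1, Thm. 1.4. [MilnorHCobordism1965]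
* M. Kervaire, J. Milnor, *Groups of homotopy spheres I*, Ann. of Math. 77 (1963), §2.
  [KervaireMilnorAnnals1963]
-/

noncomputable section

open scoped Manifold ContDiff Topology
open Set Function Metric Module
open Literature.Topology.FourManifolds

namespace Literature.Barriers.SmoothPoincare4

universe u

/-- Local notation: `𝔼 n` is the model Euclidean space `EuclideanSpace ℝ (Fin n)`. -/
local notation "𝔼 " n:arg => EuclideanSpace ℝ (Fin n)
/-- Local notation: `ℍ n` is the closed half space `EuclideanHalfSpace n`. -/
local notation "ℍ " n:arg => EuclideanHalfSpace n
/-- Local notation: `𝕊 n` is the unit sphere in `EuclideanSpace ℝ (Fin (n + 1))`. -/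
local notation "𝕊 " n:arg => (Metric.sphere (0 : EuclideanSpace ℝ (Fin (n + 1))) 1)

/-! ### Interior points and discs of a manifold with boundary -/

section Disc

variable {n : ℕ} {W : Type u} [TopologicalSpace W] [ChartedSpace (ℍ (n + 1)) W]

/-- **A nonempty manifold with boundary has an interior point**: push any point inwards in a
chart, along the inner normal `e₀` of the model half-space (the argument of the tree's
`NullCobordism.exists_isInteriorPoint`, which needs no boundary point to start from). [folklore] -/
theorem exists_isInteriorPoint_of_nonempty [IsManifold (𝓡∂ (n + 1)) ∞ W] [Nonempty W] :
    ∃ w : W, (𝓡∂ (n + 1)).IsInteriorPoint w := by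
  obtain ⟨p⟩ := ‹Nonempty W›
  set e := chartAt (ℍ (n + 1)) p with he
  set I := (𝓡∂ (n + 1)) with hI
  set z : ℍ (n + 1) := e p with hz
  set e₀ : 𝔼 (n + 1) := EuclideanSpace.single 0 1 with he₀
  set u : ℝ → 𝔼 (n + 1) := fun t => z.val + t • e₀ with hu
  have hγ : Continuous fun t => I.symm (u t) :=
    I.continuous_symm.comp (continuous_const.add (continuous_id.smul continuous_const))
  have hγ0 : I.symm (u 0) = z := by
    have : u 0 = I z := by
      rw [hI, modelWithCornersEuclideanHalfSpace_apply]
      simp [hu]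
    rw [this, I.left_inv]
  have hmem : ∀ᶠ t in 𝓝 (0 : ℝ), I.symm (u t) ∈ e.target := by
    refine hγ.continuousAt.preimage_mem_nhds ?_
    rw [hγ0]
    exact e.open_target.mem_nhds (e.map_source (mem_chart_source _ p))
  obtain ⟨ε, hε, hball⟩ := Metric.mem_nhds_iff.1 hmem
  set t : ℝ := ε / 2 with ht
  have htpos : 0 < t := by positivity
  have htε : t ∈ Metric.ball (0 : ℝ) ε := by
    rw [Metric.mem_ball, dist_zero_right, Real.norm_eq_abs, abs_of_pos htpos]; linarith
  have h1 : I.symm (u t) ∈ e.target := hball htε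
  have h2 : u t ∈ interior (range I) := by
    rw [hI, interior_range_modelWithCornersEuclideanHalfSpace]
    show 0 < (z.val + t • e₀) 0
    have hz0 : 0 ≤ z.val 0 := z.property
    simp [he₀]
    linarith
  exact ⟨(e.extend I).symm (u t),
    InteriorManifold.isInteriorPoint_extend_symm (chart_mem_atlas _ p) ⟨h1, h2⟩⟩

/-- **A nonempty manifold with boundary contains a disc**: a `C^∞` embedding `ℝⁿ⁺¹ → W` (in the
interior, `exists_isSmoothEmbedding_of_isInteriorPoint`). [folklore] -/
theorem exists_disc [IsManifold (𝓡∂ (n + 1)) ∞ W] [Nonempty W] :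
    ∃ i : 𝔼 (n + 1) → W, Manifold.IsSmoothEmbedding 𝓘(ℝ, 𝔼 (n + 1)) (𝓡∂ (n + 1)) ∞ i := by
  obtain ⟨w, hw⟩ := exists_isInteriorPoint_of_nonempty (n := n) (W := W)
  obtain ⟨i, hi, -, -, -⟩ := exists_isSmoothEmbedding_of_isInteriorPoint hw
  exact ⟨i, hi⟩

end Disc

/-! ### `S² × S²` as a summand: a disc, and the identification `ℝ² × ℝ² ≅ ℝ⁴` -/

section SphereProd

/-- **A disc in `S² × S²`**: a `C^∞` embedding `ℝ⁴ → S² × S²` for the product model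
`(𝓡 2).prod (𝓡 2)` (the inverse of the product of two stereographic charts, precomposed with a
linear identification `ℝ⁴ ≅ ℝ² × ℝ²`; as in the tree's `sphereTwoProd_discs_equivalent`). [folklore] -/
theorem exists_disc_sphereTwoProd :
    ∃ j : 𝔼 4 → (𝕊 2) × (𝕊 2), Manifold.IsSmoothEmbedding 𝓘(ℝ, 𝔼 4) ((𝓡 2).prod (𝓡 2)) ∞ j := by
  haveI : Fact (finrank ℝ (𝔼 3) = 2 + 1) := ⟨by simp⟩
  set p : 𝕊 2 := ⟨EuclideanSpace.single 0 1, by simp⟩ with hp_def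
  set σ := stereographic' 2 p with hσ_def
  have hσt : σ.target = univ := stereographic'_target p
  have hσs : σ.source = {p}ᶜ := stereographic'_source p
  have hc₀ : Manifold.IsSmoothEmbedding 𝓘(ℝ, 𝔼 2 × 𝔼 2) ((𝓡 2).prod (𝓡 2)) ∞ (σ.prod σ).symm := by
    have hsrc : (σ.prod σ).symm.source = univ := by
      rw [OpenPartialHomeomorph.symm_source, OpenPartialHomeomorph.prod_target, hσt, univ_prod_univ]
    have hΦ : ContMDiffOn 𝓘(ℝ, 𝔼 2 × 𝔼 2) ((𝓡 2).prod (𝓡 2)) ∞ (σ.prod σ).symm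
        (σ.prod σ).symm.source := by
      rw [hsrc, modelWithCornersSelf_prod, ← chartedSpaceSelf_prod]
      exact ((contMDiff_stereographic'_symm p).prodMap
        (contMDiff_stereographic'_symm p)).contMDiffOn
    have hΦ' : ContMDiffOn ((𝓡 2).prod (𝓡 2)) 𝓘(ℝ, 𝔼 2 × 𝔼 2) ∞ (σ.prod σ).symm.symm
        (σ.prod σ).symm.target := by
      rw [OpenPartialHomeomorph.symm_symm, OpenPartialHomeomorph.symm_target,
        OpenPartialHomeomorph.prod_source, hσs, modelWithCornersSelf_prod, ← chartedSpaceSelf_prod]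
      exact (contMDiffOn_stereographic' p).prodMap (contMDiffOn_stereographic' p)
    exact isSmoothEmbedding_of_openPartialHomeomorph _ hsrc hΦ hΦ'
      (ContinuousLinearEquiv.refl ℝ _)
  set Λ : 𝔼 4 ≃L[ℝ] 𝔼 2 × 𝔼 2 := ContinuousLinearEquiv.ofFinrankEq (by simp) with hΛ
  have h := isSmoothEmbedding_disc_comp_symm hc₀ (by simp) Λ.symm
  rw [ContinuousLinearEquiv.symm_symm] at h
  exact ⟨_, h⟩

/-- The identification `ℝ² × ℝ² ≅ ℝ⁴` of the model vector space of `S² × S²` with that of a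
`4`-manifold with boundary. [folklore] -/
def sphereProdLin : (𝔼 2 × 𝔼 2) ≃L[ℝ] 𝔼 4 := ContinuousLinearEquiv.ofFinrankEq (by simp)

/-- **Stabilisation data exist**: every nonempty smooth 4-manifold with boundary `W` carries the
data of a connected sum `W # (S² × S²)` along interior discs (`InteriorSumData`). [folklore] -/
theorem nonempty_stabilisationData {W : Type u} [TopologicalSpace W] [ChartedSpace (ℍ 4) W]
    [IsManifold (𝓡∂ 4) ∞ W] [Nonempty W] :
    Nonempty (InteriorSumData 3 W ((𝓡 2).prod (𝓡 2)) ((𝕊 2) × (𝕊 2))) := by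
  obtain ⟨i, hi⟩ := exists_disc (n := 3) (W := W)
  obtain ⟨j, hj⟩ := exists_disc_sphereTwoProd
  exact ⟨⟨i, j, hi, hj, sphereProdLin⟩⟩

end SphereProd

/-! ### A presentation of `W ♯ (S² × S²)` and the notion `ExtendsOverStabilisation` -/

section Presentation

variable {W : Type} [TopologicalSpace W] [T2Space W] [ChartedSpace (ℍ 4) W] [IsManifold (𝓡∂ 4) ∞ W]
  [CompactSpace W] (D : InteriorSumData 3 W ((𝓡 2).prod (𝓡 2)) ((𝕊 2) × (𝕊 2)))
  (b : BoundaryData (𝓡∂ 4) W (𝓡 3))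

/-- **A boundary diffeomorphism extending over the explicit connected sum `D.P = W ♯ (S² × S²)`
extends over a stabilisation** in the sense of `ExtendsOverStabilisation` (the presentation of
`D.P` — discs `D.i`, `D.j`, gluing embeddings `inl`, `inrY` — being the witness). [folklore] -/
theorem extendsOverStabilisation_of_extendsToDiffeomorph {f : b.carrier ≃ₘ⟮𝓡 3, 𝓡 3⟯ b.carrier}
    (h : ExtendsToDiffeomorph (D.boundaryData b) f) : ExtendsOverStabilisation b f := by
  obtain ⟨g, hg⟩ := h
  obtain ⟨h1, h2, h3, h4, h5, h6⟩ := D.isOpenGluingWith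
  exact ⟨D.P, inferInstance, inferInstance, inferInstance, inferInstance, inferInstance, D.i, D.j,
    D.glueData.inl, D.inrY, D.isSmoothEmbedding_i, D.isSmoothEmbedding_j, ⟨h1, h2, h3, h4, h5, h6⟩,
    fun x => D.incl_ne_center b x, g, hg⟩

/-- **Non-vacuity of `ExtendsOverStabilisation`**: the identity of `∂W` extends over the
stabilisation `W ♯ (S² × S²)` of every compact smooth 4-manifold with boundary (a presentation
exists, `nonempty_stabilisationData`, and the identity extends over it). [folklore] -/
theorem extendsOverStabilisation_refl [Nonempty W] (b : BoundaryData (𝓡∂ 4) W (𝓡 3)) :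
    ExtendsOverStabilisation b (Diffeomorph.refl (𝓡 3) b.carrier ∞) := by
  obtain ⟨D⟩ := nonempty_stabilisationData (W := W)
  exact extendsOverStabilisation_of_extendsToDiffeomorph D b ⟨Diffeomorph.refl (𝓡∂ 4) D.P ∞, fun _ => rfl⟩

end Presentation

/-! ### The stabilised attachment: `(W ∪_ψ X) # Y` is `(W # Y) ∪_ψ X` -/

section Attachment

variable {W : Type u} [TopologicalSpace W] [ChartedSpace (ℍ 4) W]
  {EY HY : Type*} [NormedAddCommGroup EY] [NormedSpace ℝ EY] [TopologicalSpace HY]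
  {IY : ModelWithCorners ℝ EY HY} {Y : Type u} [TopologicalSpace Y] [ChartedSpace HY Y]
  (D : InteriorSumData 3 W IY Y) (b : BoundaryData (𝓡∂ 4) W (𝓡 3))
  {N : Type u} [TopologicalSpace N] [ChartedSpace (𝔼 3) N]
  {X : Cobordism 3 b.carrier N} {ψ : b.carrier ≃ₘ⟮𝓡 3, 𝓡 3⟯ b.carrier}
  {V : Type u} [TopologicalSpace V] [ChartedSpace (ℍ 4) V]
  (A : CobordismAttachment b X ψ V)

namespace ARStab

/-- The disc of `W` misses the boundary `∂W` (a disc lies in the interior). [folklore] -/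
theorem disc_not_mem_range_incl [IsManifold (𝓡∂ 4) ∞ W] (v : 𝔼 4) : D.i v ∉ range b.incl := by
  rintro ⟨z, hz⟩
  have hint := isInteriorPoint_of_isSmoothEmbedding_disc D.isSmoothEmbedding_i v
  have hbd : b.incl z ∈ (𝓡∂ 4).boundary W := b.incl_mem_boundary z
  rw [hz] at hbd
  exact ((𝓡∂ 4).isInteriorPoint_iff_not_isBoundaryPoint _).1 hint hbd

/-- In `V = W ∪_ψ X`, the disc of `W` misses the attached cobordism `X`. [folklore] -/
theorem jW_disc_not_mem_range_jX [IsManifold (𝓡∂ 4) ∞ W] (v : 𝔼 4) : A.jW (D.i v) ∉ range A.jX := by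
  rintro ⟨x, hx⟩
  obtain ⟨z, hz, -⟩ := (A.jW_eq_jX_iff _ _).1 hx.symm
  exact disc_not_mem_range_incl D b v ⟨z, hz.symm⟩

/-- The interior piece `W ∖ ∂W` of `W`, an open submanifold (the boundary is closed). [folklore] -/
def intW [IsManifold (𝓡∂ 4) ∞ W] : TopologicalSpace.Opens W :=
  ⟨(range b.incl)ᶜ, by
    rw [b.range_incl]
    exact ((𝓡∂ 4).isClosed_boundary (M := W) (n := ∞) (by simp)).isOpen_compl⟩

/-- Membership in the interior piece. [folklore] -/
theorem mem_intW_iff [IsManifold (𝓡∂ 4) ∞ W] {w : W} : w ∈ intW b ↔ w ∉ range b.incl := Iff.rfl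

/-- The disc of `W` as a map into the interior piece. [folklore] -/
def discInt [IsManifold (𝓡∂ 4) ∞ W] (v : 𝔼 4) : intW b := ⟨D.i v, disc_not_mem_range_incl D b v⟩

/-- The disc of `W` is a smooth embedding into the interior piece. [folklore] -/
theorem isSmoothEmbedding_discInt [IsManifold (𝓡∂ 4) ∞ W] :
    Manifold.IsSmoothEmbedding 𝓘(ℝ, 𝔼 4) (𝓡∂ 4) ∞ (discInt D b) :=
  D.isSmoothEmbedding_i.codRestrict_opens (intW b) (disc_not_mem_range_incl D b)

/-- The embedding of the interior piece of `W` into `V = W ∪_ψ X`. [folklore] -/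
def jWint [IsManifold (𝓡∂ 4) ∞ W] : intW b → V := A.jW ∘ Subtype.val

/-- The interior piece of `W` embeds smoothly into `V`. [folklore] -/
theorem isSmoothEmbedding_jWint [IsManifold (𝓡∂ 4) ∞ W] [IsManifold (𝓡∂ 4) ∞ V]
    (hne : Nonempty (intW b)) :
    Manifold.IsSmoothEmbedding (𝓡∂ 4) (𝓡∂ 4) ∞ (jWint b A) := by
  have h := A.isSmoothEmbedding_jW.comp_openPartialHomeomorph
    ((intW b).openPartialHomeomorphSubtypeCoe hne) (by simp)
    (contMDiffOn_openPartialHomeomorphSubtypeCoe _ hne)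
    (contMDiffOn_openPartialHomeomorphSubtypeCoe_symm _ hne)
  rwa [TopologicalSpace.Opens.openPartialHomeomorphSubtypeCoe_coe] at h

/-- The image of the interior piece of `W` in `V` is the complement of the attached cobordism. [folklore] -/
theorem range_jWint [IsManifold (𝓡∂ 4) ∞ W] : range (jWint b A) = (range A.jX)ᶜ := by
  ext p
  constructor
  · rintro ⟨w, rfl⟩ ⟨x, hx⟩
    obtain ⟨z, hz, -⟩ := (A.jW_eq_jX_iff _ _).1 hx.symm
    exact w.2 ⟨z, hz.symm⟩
  · intro hp
    rcases A.exists_jW_eq_or p with ⟨w, rfl⟩ | ⟨x, rfl⟩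
    · refine ⟨⟨w, fun ⟨z, hz⟩ => hp ⟨X.inl (ψ z), ?_⟩⟩, rfl⟩
      rw [← hz, A.jW_incl]
    · exact (hp ⟨x, rfl⟩).elim

/-- The image of the interior piece of `W` in `V` is open. [folklore] -/
theorem isOpen_range_jWint [IsManifold (𝓡∂ 4) ∞ W] [T2Space V] : IsOpen (range (jWint b A)) := by
  rw [range_jWint]
  exact (isCompact_range A.continuous_jX).isClosed.isOpen_compl

/-- The interior piece of `W` is an open embedding into `V`. [folklore] -/
theorem isOpenEmbedding_jWint [IsManifold (𝓡∂ 4) ∞ W] [T2Space V] [IsManifold (𝓡∂ 4) ∞ V]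
    (hne : Nonempty (intW b)) : Topology.IsOpenEmbedding (jWint b A) :=
  ⟨(isSmoothEmbedding_jWint b A hne).isEmbedding, isOpen_range_jWint b A⟩

/-- **The transported disc `jW ∘ i` is a disc of `V = W ∪_ψ X`** (a smooth embedding of `ℝ⁴`):
the disc of the interior piece followed by the open smooth embedding of the interior piece into
`V` (a globally defined partial diffeomorphism; postcomposition of immersions with such). [folklore] -/
theorem isSmoothEmbedding_jW_comp_disc [IsManifold (𝓡∂ 4) ∞ W] [T2Space V] [IsManifold (𝓡∂ 4) ∞ V] :
    Manifold.IsSmoothEmbedding 𝓘(ℝ, 𝔼 4) (𝓡∂ 4) ∞ (A.jW ∘ D.i) := by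
  have hne : Nonempty (intW b) := ⟨discInt D b 0⟩
  set e := (isOpenEmbedding_jWint b A hne).toOpenPartialHomeomorph (jWint b A) with he
  have hecoe : (e : intW b → V) = jWint b A :=
    Topology.IsOpenEmbedding.toOpenPartialHomeomorph_apply _ _
  have hes : ContMDiffOn (𝓡∂ 4) (𝓡∂ 4) ∞ e e.source := by
    rw [hecoe]
    exact (isSmoothEmbedding_jWint b A hne).contMDiff.contMDiffOn
  have hes' : ContMDiffOn (𝓡∂ 4) (𝓡∂ 4) ∞ e.symm e.target := by
    rw [he, Topology.IsOpenEmbedding.toOpenPartialHomeomorph_target]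
    exact contMDiffOn_symm_of_isSmoothEmbedding (isSmoothEmbedding_jWint b A hne) _
  obtain ⟨⟨F, _, _, hF⟩, hemb⟩ := isSmoothEmbedding_discInt D b
  have key : A.jW ∘ D.i = e ∘ discInt D b := by
    funext v
    rw [comp_apply, comp_apply, hecoe]
    rfl
  rw [key]
  refine ⟨Manifold.IsImmersionOfComplement.isImmersion (F := F) fun v =>
    (hF v).openPartialHomeomorph_comp e hes hes' ?_, ?_⟩
  · rw [he, Topology.IsOpenEmbedding.toOpenPartialHomeomorph_source]
    exact mem_univ _
  · exact (isOpenEmbedding_jWint b A hne).isEmbedding.comp hemb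

variable [IsManifold (𝓡∂ 4) ∞ W] [T2Space V] [IsManifold (𝓡∂ 4) ∞ V]

/-- **The transported connected sum data on `V`**: discs `jW ∘ i` (of `V`) and `j` (of `Y`). [folklore] -/
def sumDataV : InteriorSumData 3 V IY Y :=
  ⟨A.jW ∘ D.i, D.j, isSmoothEmbedding_jW_comp_disc D b A, D.isSmoothEmbedding_j, D.L⟩

/-- The disc of the transported data is `jW ∘ i` (definitional). [folklore] -/
@[simp] theorem sumDataV_i : (sumDataV D b A).i = A.jW ∘ D.i := rfl

/-- The second disc of the transported data is `j` (definitional). [folklore] -/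
@[simp] theorem sumDataV_j : (sumDataV D b A).j = D.j := rfl

/-- The linear identification of the transported data is that of `D` (definitional). [folklore] -/
@[simp] theorem sumDataV_L : (sumDataV D b A).L = D.L := rfl

/-! #### The pieces of `V # Y` coming from `X` and from `W ∖ {i 0}` -/

/-- Points of `X` go to `V ∖ {jW (i 0)}`. [folklore] -/
theorem jX_mem_A (x : X.W) : A.jX x ∈ (sumDataV D b A).A := fun h =>
  jW_disc_not_mem_range_jX D b A 0 ⟨x, mem_singleton_iff.1 h⟩

/-- `jX` as a map into the first punctured piece `V ∖ {jW (i 0)}` of `V # Y`. [folklore] -/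
def jXpunct (x : X.W) : (sumDataV D b A).A := ⟨A.jX x, jX_mem_A D b A x⟩

/-- The underlying point of `jXpunct x` (definitional). [folklore] -/
@[simp] theorem coe_jXpunct (x : X.W) : (jXpunct D b A x : V) = A.jX x := rfl

/-- `jXpunct` is a smooth embedding. [folklore] -/
theorem isSmoothEmbedding_jXpunct :
    Manifold.IsSmoothEmbedding (𝓡∂ 4) (𝓡∂ 4) ∞ (jXpunct D b A) :=
  A.isSmoothEmbedding_jX.codRestrict_opens _ (jX_mem_A D b A)

/-- The far end `N → V ∖ {jW (i 0)}` is a smooth embedding. [folklore] -/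
theorem isSmoothEmbedding_jXpunct_comp_inr [IsManifold (𝓡 3) ∞ N] :
    Manifold.IsSmoothEmbedding (𝓡 3) (𝓡∂ 4) ∞ (jXpunct D b A ∘ X.inr) :=
  A.isSmoothEmbedding_jX_comp_inr.codRestrict_opens _ fun y => jX_mem_A D b A (X.inr y)

variable [T2Space W]


/-- Points of `W ∖ {i 0}` go to `V ∖ {jW (i 0)}`. [folklore] -/
theorem jW_mem_A (a : D.A) : A.jW a ∈ (sumDataV D b A).A := fun h =>
  a.2 (mem_singleton_iff.2 (A.injective_jW (mem_singleton_iff.1 h)))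

/-- `jW` between the first punctured pieces `W ∖ {i 0} → V ∖ {jW (i 0)}`. [folklore] -/
def jWpunct (a : D.A) : (sumDataV D b A).A := ⟨A.jW a, jW_mem_A D b A a⟩

/-- The underlying point of `jWpunct a` (definitional). [folklore] -/
@[simp] theorem coe_jWpunct (a : D.A) : (jWpunct D b A a : V) = A.jW a := rfl

/-- `jWpunct` is injective. [folklore] -/
theorem injective_jWpunct : Injective (jWpunct D b A) := fun _ _ h =>
  Subtype.ext (A.injective_jW (congrArg Subtype.val h))

/-- `jWpunct` is a smooth embedding. [folklore] -/
theorem isSmoothEmbedding_jWpunct :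
    Manifold.IsSmoothEmbedding (𝓡∂ 4) (𝓡∂ 4) ∞ (jWpunct D b A) := by
  have hval : Manifold.IsSmoothEmbedding (𝓡∂ 4) (𝓡∂ 4) ∞ (A.jW ∘ (Subtype.val : D.A → W)) := by
    have h := A.isSmoothEmbedding_jW.comp_openPartialHomeomorph
      (D.A.openPartialHomeomorphSubtypeCoe D.nonempty_A) (by simp)
      (contMDiffOn_openPartialHomeomorphSubtypeCoe _ _)
      (contMDiffOn_openPartialHomeomorphSubtypeCoe_symm _ _)
    rwa [TopologicalSpace.Opens.openPartialHomeomorphSubtypeCoe_coe] at h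
  exact hval.codRestrict_opens _ (jW_mem_A D b A)

/-! #### The connected sum relations of `W` and of `V` correspond under `jW` -/

variable [T2Space Y]

/-- Kervaire–Milnor's relation for the discs `jW ∘ i`, `j` at `jW a` is the relation for `i`, `j`
at `a`. [folklore] -/
theorem connectedSumRel_jWpunct_iff (a : D.A) (c : D.BY) :
    connectedSumRel (sumDataV D b A).i (sumDataV D b A).j (jWpunct D b A a) c ↔
      connectedSumRel D.i D.j a c := by
  simp only [connectedSumRel, sumDataV_i, sumDataV_j, comp_apply, coe_jWpunct, A.injective_jW.eq_iff]

/-! #### The embedding `W # Y → V # Y` and the attachment `V # Y = (W # Y) ∪_ψ X` -/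

variable [FiniteDimensional ℝ EY] [IY.Boundaryless] [IsManifold IY ∞ Y]

/-- Compatibility of the two pieces of the map `W # Y → V # Y` with the gluing. [folklore] -/
theorem desc_compat (a : D.A) (ha : a ∈ D.glueData.glue.source) :
    (sumDataV D b A).glueData.inl (jWpunct D b A a) =
      (sumDataV D b A).glueData.inr (D.glueData.glue a) := by
  have h1 : D.glueData.inl a = D.glueData.inr (D.toB (D.ofB (D.φ a))) := by
    rw [D.toB_ofB]
    exact D.glueData.inl_eq_inr_iff.2 ⟨ha, rfl⟩
  rw [D.inl_eq_inr_toB_iff, ← connectedSumRel_jWpunct_iff D b A,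
    ← (sumDataV D b A).inl_eq_inr_toB_iff] at h1
  exact h1

/-- **The map `W # Y → V # Y` induced by `jW : W → V`** (the identity on the summand `Y`),
descended from the two pieces. [folklore] -/
def jW₁ : D.P → (sumDataV D b A).P :=
  D.glueData.desc (fun a => (sumDataV D b A).glueData.inl (jWpunct D b A a))
    (fun c => (sumDataV D b A).glueData.inr c) (desc_compat D b A)

/-- `jW₁` on the first piece. [folklore] -/
@[simp] theorem jW₁_inl (a : D.A) :
    jW₁ D b A (D.glueData.inl a) = (sumDataV D b A).glueData.inl (jWpunct D b A a) := rfl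

/-- `jW₁` on the second piece. [folklore] -/
@[simp] theorem jW₁_inr (c : D.B) :
    jW₁ D b A (D.glueData.inr c) = (sumDataV D b A).glueData.inr c := rfl

/-- Identifications across the two pieces correspond under `jW₁`. [folklore] -/
theorem inl_jWpunct_eq_inr_iff (a : D.A) (c : D.B) :
    (sumDataV D b A).glueData.inl (jWpunct D b A a) = (sumDataV D b A).glueData.inr c ↔
      D.glueData.inl a = D.glueData.inr c := by
  have h := (sumDataV D b A).inl_eq_inr_toB_iff (jWpunct D b A a) (D.ofB c)
  rw [connectedSumRel_jWpunct_iff, ← D.inl_eq_inr_toB_iff, D.toB_ofB] at h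
  exact h

/-- `jW₁` is injective. [folklore] -/
theorem injective_jW₁ : Injective (jW₁ D b A) := by
  intro p q hpq
  rcases D.glueData.exists_inl_or_inr p with ⟨a, rfl⟩ | ⟨c, rfl⟩ <;>
    rcases D.glueData.exists_inl_or_inr q with ⟨a', rfl⟩ | ⟨c', rfl⟩
  · simp only [jW₁_inl] at hpq
    rw [injective_jWpunct D b A ((sumDataV D b A).glueData.inl_injective hpq)]
  · simp only [jW₁_inl, jW₁_inr] at hpq
    exact (inl_jWpunct_eq_inr_iff D b A a c').1 hpq
  · simp only [jW₁_inl, jW₁_inr] at hpq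
    exact ((inl_jWpunct_eq_inr_iff D b A a' c).1 hpq.symm).symm
  · simp only [jW₁_inr] at hpq
    rw [(sumDataV D b A).glueData.inr_injective hpq]

/-- **`jW₁` is an immersion** (on each piece it is, near every point, an open smooth embedding
precomposed with the inverse of the gluing embedding of `W # Y`; the complements are trivial,
`Manifold.IsImmersionAtOfComplement.punit_of_finrank_eq` of `InteriorLift.lean`, so the local
data assemble). [folklore] -/
theorem isImmersion_jW₁ : Manifold.IsImmersion (𝓡∂ 4) (𝓡∂ 4) ∞ (jW₁ D b A) := by
  refine Manifold.IsImmersionOfComplement.isImmersion (F := PUnit.{1}) fun p => ?_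
  rcases D.glueData.exists_inl_or_inr p with ⟨a, rfl⟩ | ⟨c, rfl⟩
  · obtain ⟨⟨F, _, _, hG⟩, -⟩ :=
      (sumDataV D b A).glueData.isSmoothEmbedding_inl_compH (isSmoothEmbedding_jWpunct D b A)
    haveI : Nonempty D.A := D.nonempty_A
    set Φ := (D.glueData.isOpenEmbedding_inl.toOpenPartialHomeomorph D.glueData.inl).symm with hΦ
    have hΦa : ∀ a', Φ (D.glueData.inl a') = a' := fun a' =>
      D.glueData.isOpenEmbedding_inl.toOpenPartialHomeomorph_left_inv
    have hΦs : ContMDiffOn (𝓡∂ 4) (𝓡∂ 4) ∞ Φ Φ.source := by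
      rw [hΦ, OpenPartialHomeomorph.symm_source, Topology.IsOpenEmbedding.toOpenPartialHomeomorph_target]
      exact contMDiffOn_symm_of_isSmoothEmbedding D.isSmoothEmbedding_inl _
    have hΦs' : ContMDiffOn (𝓡∂ 4) (𝓡∂ 4) ∞ Φ.symm Φ.target := by
      rw [hΦ, OpenPartialHomeomorph.symm_symm, OpenPartialHomeomorph.symm_target,
        Topology.IsOpenEmbedding.toOpenPartialHomeomorph_source,
        Topology.IsOpenEmbedding.toOpenPartialHomeomorph_apply]
      exact D.isSmoothEmbedding_inl.contMDiff.contMDiffOn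
    have hx : D.glueData.inl a ∈ Φ.source := by
      rw [hΦ, OpenPartialHomeomorph.symm_source, Topology.IsOpenEmbedding.toOpenPartialHomeomorph_target]
      exact ⟨a, rfl⟩
    have h1 := (hG (Φ (D.glueData.inl a))).comp_openPartialHomeomorph Φ hΦs hΦs' hx
    have h2 : (((sumDataV D b A).glueData.inl ∘ jWpunct D b A) ∘ Φ) =ᶠ[𝓝 (D.glueData.inl a)]
        jW₁ D b A := by
      filter_upwards [D.glueData.isOpen_range_inl.mem_nhds ⟨a, rfl⟩]
      rintro _ ⟨a', rfl⟩
      simp only [comp_apply, hΦa, jW₁_inl]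
    exact (h1.congr_of_eventuallyEq h2).punit_of_finrank_eq rfl
  · obtain ⟨⟨F, _, _, hG⟩, -⟩ := (sumDataV D b A).glueData.isSmoothEmbedding_inrH
    haveI : Nonempty D.B := D.nonempty_BY.map D.toB
    set Φ := (D.glueData.isOpenEmbedding_inr.toOpenPartialHomeomorph D.glueData.inr).symm with hΦ
    have hΦc : ∀ c', Φ (D.glueData.inr c') = c' := fun c' =>
      D.glueData.isOpenEmbedding_inr.toOpenPartialHomeomorph_left_inv
    have hΦs : ContMDiffOn (𝓡∂ 4) (𝓡∂ 4) ∞ Φ Φ.source := by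
      rw [hΦ, OpenPartialHomeomorph.symm_source, Topology.IsOpenEmbedding.toOpenPartialHomeomorph_target]
      exact contMDiffOn_symm_of_isSmoothEmbedding D.glueData.isSmoothEmbedding_inrH _
    have hΦs' : ContMDiffOn (𝓡∂ 4) (𝓡∂ 4) ∞ Φ.symm Φ.target := by
      rw [hΦ, OpenPartialHomeomorph.symm_symm, OpenPartialHomeomorph.symm_target,
        Topology.IsOpenEmbedding.toOpenPartialHomeomorph_source,
        Topology.IsOpenEmbedding.toOpenPartialHomeomorph_apply]
      exact D.glueData.isSmoothEmbedding_inrH.contMDiff.contMDiffOn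
    have hx : D.glueData.inr c ∈ Φ.source := by
      rw [hΦ, OpenPartialHomeomorph.symm_source, Topology.IsOpenEmbedding.toOpenPartialHomeomorph_target]
      exact ⟨c, rfl⟩
    have h1 := (hG (Φ (D.glueData.inr c))).comp_openPartialHomeomorph Φ hΦs hΦs' hx
    have h2 : ((sumDataV D b A).glueData.inr ∘ Φ) =ᶠ[𝓝 (D.glueData.inr c)] jW₁ D b A := by
      filter_upwards [D.glueData.isOpen_range_inr.mem_nhds ⟨c, rfl⟩]
      rintro _ ⟨c', rfl⟩
      simp only [comp_apply, hΦc, jW₁_inr]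
    exact (h1.congr_of_eventuallyEq h2).punit_of_finrank_eq rfl

/-- `jW₁` is smooth. [folklore] -/
theorem contMDiff_jW₁ : ContMDiff (𝓡∂ 4) (𝓡∂ 4) ∞ (jW₁ D b A) := fun p =>
  ((isImmersion_jW₁ D b A).isImmersionAt p).contMDiffAt

/-- **`jW₁ : W # Y → V # Y` is a smooth embedding** (an injective immersion of a compact manifold
into a Hausdorff one). [folklore] -/
theorem isSmoothEmbedding_jW₁ [CompactSpace W] [CompactSpace Y] :
    Manifold.IsSmoothEmbedding (𝓡∂ 4) (𝓡∂ 4) ∞ (jW₁ D b A) :=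
  ⟨isImmersion_jW₁ D b A,
    ((contMDiff_jW₁ D b A).continuous.isClosedEmbedding (injective_jW₁ D b A)).isEmbedding⟩

/-- **The embedding `X → V # Y`** of the attached cobordism (it misses the summand). [folklore] -/
def jX₁ : X.W → (sumDataV D b A).P := (sumDataV D b A).glueData.inl ∘ jXpunct D b A

omit [T2Space W] in
/-- `jX₁ = inl ∘ jXpunct` (definitional). [folklore] -/
theorem jX₁_apply (x : X.W) : jX₁ D b A x = (sumDataV D b A).glueData.inl (jXpunct D b A x) := rfl

/-- The seam of the stabilised attachment, first piece: `jW₁ (inl a) = jX₁ x` iff `a` is a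
boundary point `incl z` and `x = inl (ψ z)`. [folklore] -/
theorem jW₁_inl_eq_jX₁_iff (a : D.A) (x : X.W) :
    jW₁ D b A (D.glueData.inl a) = jX₁ D b A x ↔
      ∃ z, D.glueData.inl a = (D.boundaryData b).incl z ∧ x = X.inl (ψ z) := by
  rw [jW₁_inl, jX₁_apply, (sumDataV D b A).glueData.inl_injective.eq_iff, Subtype.ext_iff,
    coe_jWpunct, coe_jXpunct, A.jW_eq_jX_iff]
  constructor
  · rintro ⟨z, hz, hx⟩
    refine ⟨z, ?_, hx⟩
    rw [D.boundaryData_incl]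
    congr 1
    exact Subtype.ext hz
  · rintro ⟨z, hz, hx⟩
    refine ⟨z, ?_, hx⟩
    rw [D.boundaryData_incl] at hz
    rw [D.glueData.inl_injective hz]
    rfl

/-- The seam of the stabilised attachment, second piece: the summand `Y` meets neither `X` nor
`∂W`. [folklore] -/
theorem jW₁_inr_ne_jX₁ (c : D.B) (x : X.W) : jW₁ D b A (D.glueData.inr c) ≠ jX₁ D b A x := by
  rw [jW₁_inr, jX₁_apply]
  intro h
  have h' := ((sumDataV D b A).glueData.inl_eq_inr_iff.1 h.symm).1
  rw [(sumDataV D b A).glueData_glue, (sumDataV D b A).φ_source,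
    (sumDataV D b A).mem_φY_source] at h'
  obtain ⟨⟨v, hv⟩, -⟩ := (sumDataV D b A).mem_Φ_source.1 h'
  exact jW_disc_not_mem_range_jX D b A v ⟨x, hv.symm⟩

omit [T2Space V] [IsManifold (𝓡∂ 4) ∞ V] in
/-- The summand `Y` does not meet the boundary `∂W`. [folklore] -/
theorem inr_ne_incl (c : D.B) (z : b.carrier) : D.glueData.inr c ≠ (D.boundaryData b).incl z := by
  intro h
  rw [D.boundaryData_incl] at h
  have h' := (D.glueData.inl_eq_inr_iff.1 h.symm).1
  rw [D.glueData_glue, D.φ_source, D.mem_φY_source] at h'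
  obtain ⟨⟨v, hv⟩, -⟩ := D.mem_Φ_source.1 h'
  exact disc_not_mem_range_incl D b v ⟨z, hv.symm⟩

/-- **The stabilised attachment `V # Y = (W # Y) ∪_ψ X`.** For every witness `V` of `W ∪_ψ X`
(`A : CobordismAttachment b X ψ V`), the connected sum `V # Y` along the transported disc
`jW ∘ i` (the explicit glued manifold `(sumDataV D b A).P`) is a witness of the attachment of `X`
to the connected sum `W # Y` (the explicit glued manifold `D.P`, boundary datum `D.boundaryData b`)
along the same `ψ`: connected sum in the interior and attachment along the boundary commute.
(Milnor 1965, Thm. 1.4; Kervaire–Milnor 1963, §2 — implicit in Kang's "`V ♯ (S² × S²)`,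
`V′ ♯ (S² × S²)`" for `V = W ∪ X`.) [cite: MilnorHCobordism1965, §1, Thm. 1.4] -/
def attachment [CompactSpace W] [CompactSpace Y] [IsManifold (𝓡 3) ∞ N] :
    CobordismAttachment (D.boundaryData b) X ψ (sumDataV D b A).P where
  jW := jW₁ D b A
  jX := jX₁ D b A
  isSmoothEmbedding_jW := isSmoothEmbedding_jW₁ D b A
  isSmoothEmbedding_jX :=
    (sumDataV D b A).glueData.isSmoothEmbedding_inl_compH (isSmoothEmbedding_jXpunct D b A)
  range_union := by
    refine eq_univ_of_forall fun p => ?_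
    rcases (sumDataV D b A).glueData.exists_inl_or_inr p with ⟨v, rfl⟩ | ⟨c, rfl⟩
    · rcases A.exists_jW_eq_or (v : V) with ⟨w, hw⟩ | ⟨x, hx⟩
      · have hw0 : w ∈ D.A := fun h => v.2 (by
          rw [mem_singleton_iff] at h ⊢
          rw [← hw, h]
          rfl)
        refine Or.inl ⟨D.glueData.inl ⟨w, hw0⟩, ?_⟩
        rw [jW₁_inl]
        congr 1
        exact Subtype.ext hw
      · refine Or.inr ⟨x, ?_⟩
        rw [jX₁_apply]
        congr 1
        exact Subtype.ext hx
    · exact Or.inl ⟨D.glueData.inr c, jW₁_inr D b A c⟩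
  jW_eq_jX_iff := by
    intro p x
    rcases D.glueData.exists_inl_or_inr p with ⟨a, rfl⟩ | ⟨c, rfl⟩
    · exact jW₁_inl_eq_jX₁_iff D b A a x
    · refine iff_of_false (jW₁_inr_ne_jX₁ D b A c x) ?_
      rintro ⟨z, hz, -⟩
      exact inr_ne_incl D b c z hz
  isSmoothEmbedding_jX_comp_inr :=
    (sumDataV D b A).glueData.isSmoothEmbedding_inl_compH (isSmoothEmbedding_jXpunct_comp_inr D b A)
  range_jX_comp_inr := by
    rw [(sumDataV D b A).boundary_P_eq, ← A.range_jX_comp_inr]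
    ext p
    constructor
    · rintro ⟨y, rfl⟩
      exact ⟨jXpunct D b A (X.inr y), ⟨y, rfl⟩, rfl⟩
    · rintro ⟨v, ⟨y, hy⟩, rfl⟩
      refine ⟨y, ?_⟩
      show (sumDataV D b A).glueData.inl (jXpunct D b A (X.inr y)) = _
      congr 1
      exact Subtype.ext hy

/-- The far-end boundary datum of the stabilised attachment has carrier `N` and inclusion
`jX₁ ∘ inr` (definitional). [folklore] -/
theorem attachment_boundaryData_incl [CompactSpace W] [CompactSpace Y] [IsManifold (𝓡 3) ∞ N] (y : N) :
    (attachment D b A).boundaryData.incl y = jX₁ D b A (X.inr y) := rfl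

end ARStab

end Attachment

/-! ### The stabilised Akbulut–Ruberman construction from the parts of Thm. A -/

section Main

/-- A contractible space is nonempty. [folklore] -/
theorem nonempty_of_contractibleSpace (W : Type u) [TopologicalSpace W] [ContractibleSpace W] :
    Nonempty W :=
  ⟨(Classical.choice (ContractibleSpace.hequiv_unit' (X := W))).invFun ()⟩

set_option maxHeartbeats 800000 in
/-- **The stabilised Akbulut–Ruberman construction (`kang2022_akbulutRubermanStabilised`) from
the symmetry-killing invertible cobordism (C) and relative exoticness (R) of Akbulut–Ruberman's
Thm. A** — Kang's "By following the arguments used in the proof of [AR16, Theorem A] … with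
`W ♯ (S² × S²)` in place of `W`", made formal. Given a compact contractible `W`, a boundary datum
`b` and a boundary diffeomorphism `f` extending over no stabilisation:
* `P₀ = W ♯ (S² × S²)` is the explicit connected sum `D.P` along interior discs
  (`nonempty_stabilisationData`), a compact 4-manifold with boundary datum `D.boundaryData b`
  (carrier `∂W`);
* (C) (`hC`, the tree's `akbulutRuberman2016_symmetryKillingCobordism`) gives the invertible
  cobordism `X : ∂W → N` with the far-end extension property and contractible attachments;
* `V = W ∪ X`, `V′ = W ∪_f X` exist (Milnor's Thm. 1.4, the tree's PROVED
  `exists_cobordismAttachment_holds`), are compact and contractible, with `∂V = N = ∂V′`;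
* `V ♯ (S² × S²) = P₀ ∪ X` and `V′ ♯ (S² × S²) = P₀ ∪_f X` (`ARStab.attachment`: connected sum
  in the interior commutes with attachment along the boundary);
* every self-diffeomorphism of `N = ∂(P₀ ∪_f X)` extends (the tree's PROVED
  `akbulutRuberman2016_boundaryDiffeosExtend_holds`, i.e. the Claim plus collars), so by
  Lemma 1.2 (`isEmpty_diffeomorph_of_lemma12`, proved) a diffeomorphism
  `V ♯ (S² × S²) ≅ V′ ♯ (S² × S²)` could be taken marked on `N`, whence by (R) (`hR`, the tree's
  `akbulutRuberman2016_relativelyExotic`, applied to the compact manifold `P₀`) `f` would extend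
  to a self-diffeomorphism of `P₀ = W ♯ (S² × S²)` — i.e. `ExtendsOverStabilisation b f`
  (`extendsOverStabilisation_of_extendsToDiffeomorph`), contradicting the hypothesis.
Hence the child fact follows from the two named facts (C), (R) of
`ExoticContractibleTheoremAProofs.lean` (both leaves of the UNSTABILISED Thm. A already); no
stabilised analogue of either is needed.
[cite: Kang2022OneStabilization, proof of Cor. 1.2 (§5)] [cite: AkbulutRuberman2016, §3, proof of Thm. A] -/
theorem kang2022_akbulutRubermanStabilised_of_AR
    (hC : akbulutRuberman2016_symmetryKillingCobordism.{0})
    (hR : akbulutRuberman2016_relativelyExotic.{0}) : kang2022_akbulutRubermanStabilised := by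
  intro W _ _ _ _ _ _ _ b f hf
  haveI : Nonempty W := nonempty_of_contractibleSpace W
  obtain ⟨D⟩ := nonempty_stabilisationData (W := W)
  obtain ⟨N, _, _, _, X, hInv, hFar, hContr⟩ := hC W b
  obtain ⟨V, _, _, _, _, _, ⟨A⟩⟩ := exists_cobordismAttachment_four exists_cobordismAttachment_holds
    W b b.carrier N X (Diffeomorph.refl (𝓡 3) b.carrier ∞)
  obtain ⟨V', _, _, _, _, _, ⟨A'⟩⟩ := exists_cobordismAttachment_four
    exists_cobordismAttachment_holds W b b.carrier N X f
  haveI : CompactSpace V := A.compactSpace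
  haveI : CompactSpace V' := A'.compactSpace
  haveI : ContractibleSpace V := hContr _ V ⟨A⟩
  haveI : ContractibleSpace V' := hContr f V' ⟨A'⟩
  -- the stabilised attachments `V ♯ (S² × S²) = P₀ ∪ X`, `V′ ♯ (S² × S²) = P₀ ∪_f X`
  let A₁ := ARStab.attachment D b A
  let A₁' := ARStab.attachment D b A'
  -- (S), proved in the tree: every boundary diffeomorphism of `P₀ ∪_f X` extends
  have hS : ∀ g : N ≃ₘ⟮𝓡 3, 𝓡 3⟯ N, ExtendsToDiffeomorph A₁'.boundaryData g := fun g =>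
    akbulutRuberman2016_boundaryDiffeosExtend_holds D.P (D.boundaryData b) f N X hFar _ A₁' g
  -- (R) and the hypothesis on `f`: no diffeomorphism marked on `N`
  have hRel : ∀ Ψ : (ARStab.sumDataV D b A).P ≃ₘ⟮𝓡∂ 4, 𝓡∂ 4⟯ (ARStab.sumDataV D b A').P,
      ¬ ∀ z, Ψ (A₁.boundaryData.incl z) =
        A₁'.boundaryData.incl ((Diffeomorph.refl (𝓡 3) N ∞) z) := by
    intro Ψ hΨ
    apply hf
    apply extendsOverStabilisation_of_extendsToDiffeomorph D b
    have hmark : ∃ Φ : (ARStab.sumDataV D b A').P ≃ₘ⟮𝓡∂ 4, 𝓡∂ 4⟯ (ARStab.sumDataV D b A).P,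
        ∀ y : N, Φ (A₁'.jX (X.inr y)) = A₁.jX (X.inr y) := by
      refine ⟨Ψ.symm, fun y => ?_⟩
      have h : Ψ (A₁.jX (X.inr y)) = A₁'.jX (X.inr y) := hΨ y
      rw [← h, Diffeomorph.symm_apply_apply]
    exact hR D.P (D.boundaryData b) f N X hInv _ _ A₁ A₁' hmark
  have hE : IsEmpty ((ARStab.sumDataV D b A).P ≃ₘ⟮𝓡∂ 4, 𝓡∂ 4⟯ (ARStab.sumDataV D b A').P) :=
    isEmpty_diffeomorph_of_lemma12 A₁.boundaryData A₁'.boundaryData (Diffeomorph.refl (𝓡 3) N ∞)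
      hS hRel
  exact ⟨V, V', ‹_›, ‹_›, ‹_›, ‹_›, ‹_›, ‹_›, ‹_›, ‹_›, ‹_›, ‹_›, ‹_›, ‹_›, ‹_›, ‹_›,
    A.boundaryData, A'.boundaryData, (ARStab.sumDataV D b A).P, (ARStab.sumDataV D b A').P,
    inferInstance, inferInstance, inferInstance, inferInstance, inferInstance,
    inferInstance, inferInstance, inferInstance, inferInstance, inferInstance,
    ⟨Diffeomorph.refl (𝓡 3) N ∞⟩, (ARStab.sumDataV D b A).isConnectedSum,
    (ARStab.sumDataV D b A').isConnectedSum, hE⟩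

/-- **`kang2022_oneStabilisationExoticPair` from Kang's Thm. 1.1 and the two leaves (C), (R) of
Akbulut–Ruberman's Thm. A** (`kang2022_oneStabilisationExoticPair_of_theorem11` with its second
hypothesis discharged by `kang2022_akbulutRubermanStabilised_of_AR`).
[cite: Kang2022OneStabilization, proof of Cor. 1.2 (§5)] -/
theorem kang2022_oneStabilisationExoticPair_of_theorem11_AR (h11 : kang2022_theorem11)
    (hC : akbulutRuberman2016_symmetryKillingCobordism.{0})
    (hR : akbulutRuberman2016_relativelyExotic.{0}) : kang2022_oneStabilisationExoticPair :=
  kang2022_oneStabilisationExoticPair_of_theorem11 h11 (kang2022_akbulutRubermanStabilised_of_AR hC hR)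

/-- **`OneStabilisationBarrier` from Kang's Thm. 1.1, the leaves (C), (R) of Akbulut–Ruberman's
Thm. A, and Freedman–Quinn** (`oneStabilisationBarrier_of_theorem11` with the stabilised
Akbulut–Ruberman construction discharged). [cite: Kang2022OneStabilization, Thm. 1.1 and Cor. 1.2] -/
theorem oneStabilisationBarrier_of_theorem11_AR (h11 : kang2022_theorem11)
    (hC : akbulutRuberman2016_symmetryKillingCobordism.{0})
    (hR : akbulutRuberman2016_relativelyExotic.{0})
    (hF : freedmanQuinn1990_homeomorph_extends_contractible.{0}) : OneStabilisationBarrier :=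
  oneStabilisationBarrier_of_theorem11 h11 (kang2022_akbulutRubermanStabilised_of_AR hC hR) hF

end Main

end Literature.Barriers.SmoothPoincare4
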